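import Literature.Computability.Complexity.GateEliminationCase54AffineBD
import Literature.Computability.Complexity.GateEliminationCase54
import Literature.Computability.Complexity.GateEliminationDoomedSharp

/-!
# Gate elimination: the protected leaf of Case 5.4.1.3 of Li–Yang's Theorem 4.1

"In the case that `z` is protected, after constant substitution to `x`, trivializing `G` and then
degenerating `B` and `D`, we can further substitute a constant to `z` such that `E` is
trivialized, which will degenerate the descendant of `E` and `z` (which was passed from `D`).
During the whole process, `6` gates are removed while introducing at most `6` troubled gates since
all gates are removed via Rule 2 and Rule 3. A quadratic equation involving `z` is also removed.
So in a nutshell, `Δμ ≥ (6 - 6α_φ + 2α_I + α_Q)/2 ≥ δ` per substitution." (ECCC TR21-023, §4.1,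
Case 5.4.1.3.) PROVED here as `case5_protected_second` in the local form used by the Case 5.4
dispatcher (hypothesis `hF5` of `LiYang2022_case5_4_holds_aux`): the chain `x := b`, `G`, `D`
(the ⊕-type `D` bypassed, passing the protected `u` — the paper's `z`), then `u := c'`
trivializing `E`, the elimination of `E`, and three more doomed gates (`B`, the other reader of
`D`, and a descendant).

## References

* J. Li, T. Yang, *3.1n − o(n) circuit lower bounds for explicit functions*, STOC 2022;
  ECCC TR21-023, §2.4, §4.1 (Case 5.4.1.3), Lemma 3.11.
-/

namespace Literature.Computability.Complexity

open Finset

namespace Semicircuit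

variable {n : ℕ} {C : Semicircuit n} {f : (Fin n → ZMod 2) → Bool} {R : RdqSource n} {d : ℕ}
  {αφ αI αQ : ℝ} {G : Fin C.m} {x y : Fin n} {B C' D : Fin C.m} {aX aB aC aD : Fin 2}

/-- `2δ ≤ 2α_I + (2 - 2α_φ + α_Q) + (4 - 4α_φ)`. [cite: LiYang2022, Lemma 3.11 / proof of Thm. 1.1] -/
theorem two_liYangDelta_le (αφ αI αQ : ℝ) : 2 * liYangDelta αφ αI αQ ≤ 2 * αI + (2 - 2 * αφ + αQ) + (4 - 4 * αφ) := by
  have h1 : liYangDelta αφ αI αQ ≤ αI + (2 - 2 * αφ + αQ) := by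
    unfold liYangDelta
    have : min (αI / 3) (min (2 - 2 * αφ + αQ) (min (4 - 4 * αφ) (min (3 + αφ) (min (5 - αQ) ((5 - 2 * αφ + αQ) / 2))))) ≤
        2 - 2 * αφ + αQ := (min_le_right _ _).trans (min_le_left _ _)
    linarith
  have h2 := liYangDelta_le_case3 αφ αI αQ
  linarith

/-- **Case 5.4.1.3 of the proof of Thm. 4.1** (second substitution to the protected variable):
`D` is not ∧-type, reads `G` and the protected `1`-variable `u`, and has two readers; the ∧-type
`1`-gate `E` reads `D` (at `aE`) and either a `2`-variable `t` or the gate `B`; `D` does not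
feed `B`. Two substitutions, `Δμ ≥ 6 - 5α_φ + 2α_I + α_Q ≥ 2δ`. [cite: LiYang2022, §4.1 (Case 5.4.1.3)] -/
theorem case5_protected_second (hf : IsAffineDisperser f d) (hd : 2 * d + 2 < R.dim) (hF : C.Fair)
    (hC : C.ComputesRestr f R) (hS : C.Standing R) (hcfg : C.Case5Config G x y B C' D aX aB aC aD)
    (hφ0 : 0 < αφ) (hI0 : 0 < αI) (hBC : B ≠ C') (hnDB : ¬ C.Reads D B)
    {E : Fin C.m} {aE : Fin 2} {u : Fin n} (hDn : ¬ IsAndOp (C.op D)) (hIu : C.arg D aD.rev = .var u)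
    (hup : R.Protected u) (_hu1 : C.fanout (.var u) = 1) (hD2 : C.fanout (.gate D) = 2)
    (hEand : IsAndOp (C.op E)) (hED : C.arg E aE = .gate D) (hE1 : C.fanout (.gate E) = 1)
    (hEo : (∃ t, C.arg E aE.rev = .var t ∧ C.fanout (.var t) = 2) ∨ C.arg E aE.rev = .gate B) :
    C.StepGoal f R αφ αI αQ := by
  classical
  have hφ' := hφ0.le
  have hI' := hI0.le
  have hN := hS.normalized.1
  have hGK := hcfg.G_not_mem
  have hDK : D ∉ C.xorPart := fun hDK => hGK (C.mem_of_arg_eq D hDK aD G hcfg.arg_D)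
  have hEK : E ∉ C.xorPart := C.not_mem_xorPart_of_isAndOp hEand
  obtain ⟨cD, hcD⟩ : IsXorOp (C.op D) := C.isXorOp_of_isAffineOp hS.nonDegenerate ((isAndOp_or_isAffineOp _).resolve_left hDn)
  have hux : u ≠ x := fun h => case5_D_not_x hS hcfg aD.rev (by rw [hIu, h])
  have huy : u ≠ y := fun h => case5_D_not_y hS hcfg aD.rev (by rw [hIu, h])
  have hIG := case5_arg_D_rev_ne_G hS hcfg
  have hDout : C.out ≠ .gate D := out_ne_of_read_bYacyclic hS hEK ⟨aE, hED⟩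
  have hED' : E ≠ D := fun h => by rw [h] at hED; exact C.arg_ne_self_of_not_mem hDK _ hED
  have hEG : E ≠ G := by
    intro h; rw [h] at hED
    rcases fin2_eq_or_eq_rev aX aE with e' | e'
    · rw [e', hcfg.arg_G_x] at hED; cases hED
    · rw [e', hcfg.arg_G_y] at hED; cases hED
  have hEB' : E ≠ B := fun h => hnDB ⟨aE, by rw [← h]; exact hED⟩
  -- the other reader `E'` of `D`
  have hED1 : (univ.filter fun a : Fin 2 => C.arg E a = .gate D).card ≤ 1 := by
    rw [card_le_one]
    intro a ha b' hb'
    rw [mem_filter] at ha hb'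
    have key : ∀ a', C.arg E a' = .gate D → a' = aE := by
      intro a' h
      rcases fin2_eq_or_eq_rev aE a' with e' | e'
      · exact e'
      · rw [e'] at h
        rcases hEo with ⟨t, ht, -⟩ | hB
        · rw [ht] at h; cases h
        · rw [hB] at h; cases h; exact absurd rfl (case5_B_ne_D hS hcfg)
    rw [key a ha.2, key b' hb'.2]
  obtain ⟨E', aE', hE'E, hE'D⟩ := exists_reader_ne (by omega) hED1
  have hE'D' : E' ≠ D := fun h => by rw [h] at hE'D; exact C.arg_ne_self_of_not_mem hDK _ hE'D
  have hE'G : E' ≠ G := by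
    intro h; rw [h] at hE'D
    rcases fin2_eq_or_eq_rev aX aE' with e' | e'
    · rw [e', hcfg.arg_G_x] at hE'D; cases hE'D
    · rw [e', hcfg.arg_G_y] at hE'D; cases hE'D
  have hE'B : E' ≠ B := fun h => hnDB ⟨aE', by rw [← h]; exact hE'D⟩
  -- step 1: `x := b`, eliminate `G`
  have hrepl₁ := case5E₁_repl hf hd hF hC hS hcfg hφ' hI' αQ
  have hkD := case5kD_spec hf hd hF hC hS hcfg hφ' hI' αQ
  have hkB₁ := case5kB₁_spec hf hd hF hC hS hcfg hφ' hI' αQ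
  have hkDc := case5_arg_kD hf hd hF hC hS hcfg hφ' hI' αQ
  have hkDrev := case5_arg_kD_rev hf hd hF hC hS hcfg hφ' hI' αQ
  have hkDu : (case5E₁ hf hd hF hC hS hcfg hφ' hI' αQ).C'.arg (case5kD hf hd hF hC hS hcfg hφ' hI' αQ) aD.rev = .var u := by
    rw [hkDrev, hIu]; rfl
  have hd₁ : 2 * d + 2 ≤ (case5R₁ hC hS hcfg).dim := (case5R₁_dim hC hS hcfg).mpr hd
  have hx : R.Free x := case5_free_x hC hcfg
  have hxp : ¬ R.Protected x := case5_unprot_x hS hcfg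
  -- wires of `C₁`
  have hC₁var : ∀ {k : Fin C.m} {a : Fin 2} {v : Fin n}, (case5C₁ hcfg).arg k a = .var v ↔ C.arg k a = .var v ∧ v ≠ x := by
    intro k a v
    rw [case5C₁_arg]
    cases hka : C.arg k a with
    | const c => exact ⟨(fun h => by cases h), fun h => by cases h.1⟩
    | var i =>
      by_cases hix : i = x
      · rw [hix, Node.substConst_var_self]
        exact ⟨(fun h => by cases h), fun h => absurd (Node.var.inj h.1).symm h.2⟩
      · rw [Node.substConst_var_of_ne hix]
        exact ⟨(fun h => ⟨h, by cases h; exact hix⟩), fun h => h.1⟩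
    | gate g => exact ⟨(fun h => by cases h), fun h => by cases h.1⟩
  have hC₁gate : ∀ {k : Fin C.m} {a : Fin 2} {g : Fin C.m}, (case5C₁ hcfg).arg k a = .gate g ↔ C.arg k a = .gate g := by
    intro k a g
    rw [case5C₁_arg]
    cases hka : C.arg k a with
    | const c => exact ⟨(fun h => by cases h), fun h => by cases h⟩
    | var i =>
      by_cases hix : i = x
      · rw [hix, Node.substConst_var_self]; exact ⟨(fun h => by cases h), fun h => by cases h⟩
      · rw [Node.substConst_var_of_ne hix]
    | gate g' => exact Iff.rfl
  -- step 2: bypass the ⊕-type `(case5kD hf hd hF hC hS hcfg hφ' hI' αQ)`, passing `u`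
  have hxorD : IsXorOp ((case5E₁ hf hd hF hC hS hcfg hφ' hI' αQ).C'.op (case5kD hf hd hF hC hS hcfg hφ' hI' αQ)) := (case5E₁ hf hd hF hC hS hcfg hφ' hI' αQ).isXorOp_of (by rw [hkD]; exact ⟨cD, hcD⟩)
  obtain ⟨c₁, hc₁⟩ := hxorD
  set bG := (case5C₁ hcfg).liveFn G aX (case5b hcfg) false with hbG
  have hdegD : ∀ t', (case5E₁ hf hd hF hC hS hcfg hφ' hI' αQ).C'.liveFn (case5kD hf hd hF hC hS hcfg hφ' hI' αQ) aD bG t' = (t' ^^ (bG ^^ c₁)) := by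
    intro t'
    show (if aD = 0 then (case5E₁ hf hd hF hC hS hcfg hφ' hI' αQ).C'.op (case5kD hf hd hF hC hS hcfg hφ' hI' αQ) bG t' else (case5E₁ hf hd hF hC hS hcfg hφ' hI' αQ).C'.op (case5kD hf hd hF hC hS hcfg hφ' hI' αQ) t' bG) = _
    split_ifs <;> rw [hc₁] <;> cases t' <;> cases bG <;> cases c₁ <;> rfl
  have houtD₁ : (case5E₁ hf hd hF hC hS hcfg hφ' hI' αQ).C'.out ≠ .gate (case5kD hf hd hF hC hS hcfg hφ' hI' αQ) := by
    intro h
    have := (case5E₁ hf hd hF hC hS hcfg hφ' hI' αQ).out_eq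
    rw [h, if_neg (case5C₁_out_ne hf hd hF hC hS hcfg)] at this
    change Node.gate ((case5E₁ hf hd hF hC hS hcfg hφ' hI' αQ).ι (case5kD hf hd hF hC hS hcfg hφ' hI' αQ)) = (case5C₁ hcfg).out at this
    rw [hkD] at this
    obtain ⟨ko, hko⟩ := exists_out_eq_gate' hf hF hC (by omega)
    have hC₁out : (case5C₁ hcfg).out = .gate ko := by show (C.out).substConst x (finTwoEquiv (case5c hcfg)) = _; rw [hko]; rfl
    rw [hC₁out] at this; cases this; exact hDout hko
  let E₂ := elimDataWBypass (case5E₁ hf hd hF hC hS hcfg hφ' hI' αQ).fair (case5E₁ hf hd hF hC hS hcfg hφ' hI' αQ).computes (case5E₁ hf hd hF hC hS hcfg hφ' hI' αQ).packing (bG ^^ c₁) hkDc hdegD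
    houtD₁ hφ' hI' αQ
  have hr₂ : E₂.repl = .var u := hkDu
  -- images after steps 1, 2
  obtain ⟨kE₁, hkE₁⟩ := (case5E₁ hf hd hF hC hS hcfg hφ' hI' αQ).ι_surj E hEG
  obtain ⟨kE'₁, hkE'₁⟩ := (case5E₁ hf hd hF hC hS hcfg hφ' hI' αQ).ι_surj E' hE'G
  have hkE₁D : kE₁ ≠ (case5kD hf hd hF hC hS hcfg hφ' hI' αQ) := by
    intro h; apply hED'; have := congrArg (case5E₁ hf hd hF hC hS hcfg hφ' hI' αQ).ι h; rw [hkE₁, hkD] at this; exact this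
  have hkE'₁D : kE'₁ ≠ (case5kD hf hd hF hC hS hcfg hφ' hI' αQ) := by
    intro h; apply hE'D'; have := congrArg (case5E₁ hf hd hF hC hS hcfg hφ' hI' αQ).ι h; rw [hkE'₁, hkD] at this; exact this
  obtain ⟨kE₂, hkE₂⟩ := E₂.ι_surj kE₁ hkE₁D
  obtain ⟨kE'₂, hkE'₂⟩ := E₂.ι_surj kE'₁ hkE'₁D
  obtain ⟨kB₂, hkB₂⟩ := E₂.ι_surj (case5kB₁ hf hd hF hC hS hcfg hφ' hI' αQ) (case5kB₁_ne hf hd hF hC hS hcfg hφ' hI' αQ)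
  have hE₁D : (case5E₁ hf hd hF hC hS hcfg hφ' hI' αQ).C'.arg kE₁ aE = .gate (case5kD hf hd hF hC hS hcfg hφ' hI' αQ) := by rw [(case5E₁ hf hd hF hC hS hcfg hφ' hI' αQ).arg_eq_gate_iff, hkE₁, hkD]; exact Or.inl (hC₁gate.mpr hED)
  have hE'₁D : (case5E₁ hf hd hF hC hS hcfg hφ' hI' αQ).C'.arg kE'₁ aE' = .gate (case5kD hf hd hF hC hS hcfg hφ' hI' αQ) := by rw [(case5E₁ hf hd hF hC hS hcfg hφ' hI' αQ).arg_eq_gate_iff, hkE'₁, hkD]; exact Or.inl (hC₁gate.mpr hE'D)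
  have hE₂u : E₂.C'.arg kE₂ aE = .var u := by rw [E₂.arg_eq_var_iff, hkE₂]; exact Or.inr ⟨hE₁D, hr₂⟩
  have hE'₂u : E₂.C'.arg kE'₂ aE' = .var u := by rw [E₂.arg_eq_var_iff, hkE'₂]; exact Or.inr ⟨hE'₁D, hr₂⟩
  have hB₂c : E₂.C'.arg kB₂ aB = .const (case5b hcfg) := by
    rw [E₂.arg_eq_const_iff, hkB₂]; exact Or.inl (case5_arg_kB₁ hf hd hF hC hS hcfg hφ' hI' αQ)
  have hkEE' : kE₂ ≠ kE'₂ := fun h => hE'E (by rw [← hkE'₁, ← hkE₁, ← hkE₂, ← hkE'₂, h])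
  have hkEB : kE₂ ≠ kB₂ := fun h => hEB' (by rw [← hkB₁, ← hkE₁, ← hkE₂, ← hkB₂, h])
  have hkE'B : kE'₂ ≠ kB₂ := fun h => hE'B (by rw [← hkB₁, ← hkE'₁, ← hkE'₂, ← hkB₂, h])
  -- step 3: `u := c'`, killing the quadratic equation of `u`, trivializing the image of `E`
  have hup₁ : (case5R₁ hC hS hcfg).Protected u := (RdqSource.protected_assignFree_iff hx hxp u).mpr hup
  obtain ⟨-, l, e, he, hr⟩ := hup₁
  have handE₂ : IsAndOp (E₂.C'.op kE₂) :=
    (E₂.isAndOp_iff kE₂).mpr (((case5E₁ hf hd hF hC hS hcfg hφ' hI' αQ).isAndOp_iff kE₁).mpr (by rw [hkE₁]; exact hEand) |> fun h => by rw [hkE₂]; exact h)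
  obtain ⟨k', hk'⟩ := exists_trivializing handE₂ aE
  let c' : ZMod 2 := finTwoEquiv.symm k'
  have hc' : finTwoEquiv c' = k' := finTwoEquiv.apply_symm_apply k'
  let C₃ := E₂.C'.substConst u (finTwoEquiv c')
  let R₃ := (case5R₁ hC hS hcfg).assignProtected he hr c'
  have hF₃ : C₃.Fair := E₂.fair.substConst u _
  have hC₃ : C₃.ComputesRestr f R₃ := E₂.computes.substConst_assignProtected he hr c'
  have hP₃ : C₃.IsPacking (E₂.C'.substConstPacking u (finTwoEquiv c') E₂.P') := E₂.packing.substConst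
  have hdim₃ : R₃.dim + 2 = R.dim := by
    have h1 := RdqSource.dim_assignProtected he hr c'
    have h2 := RdqSource.dim_assignFree (b := case5c hcfg) hx hxp
    change R₃.dim + 1 = (case5R₁ hC hS hcfg).dim at h1
    change (case5R₁ hC hS hcfg).dim + 1 = R.dim at h2
    omega
  have hE₃c : C₃.arg kE₂ aE = .const k' := by
    show (E₂.C'.arg kE₂ aE).substConst u (finTwoEquiv c') = _; rw [hE₂u, Node.substConst_var_self, hc']
  have hE'₃c : C₃.arg kE'₂ aE' = .const k' := by
    show (E₂.C'.arg kE'₂ aE').substConst u (finTwoEquiv c') = _; rw [hE'₂u, Node.substConst_var_self, hc']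
  have hB₃c : C₃.arg kB₂ aB = .const (case5b hcfg) := by
    show (E₂.C'.arg kB₂ aB).substConst u (finTwoEquiv c') = _; rw [hB₂c]; rfl
  have htriv₃ : C₃.liveFn kE₂ aE k' false = C₃.liveFn kE₂ aE k' true := hk'
  have hout₃ : C₃.out ≠ .gate kE₂ := out_ne_of_trivialized hf (by omega) hF₃ hC₃ hE₃c htriv₃
  -- step 4: eliminate the image of `E`
  let E₄ := elimDataWTriv hF₃ hC₃ hP₃ hE₃c htriv₃ hout₃ hφ' hI' αQ
  have hr₄ : E₄.repl = .const (C₃.liveFn kE₂ aE k' false) := rfl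
  obtain ⟨kE'₄, hkE'₄⟩ := E₄.ι_surj kE'₂ hkEE'.symm
  obtain ⟨kB₄, hkB₄⟩ := E₄.ι_surj kB₂ hkEB.symm
  have hE'₄c : E₄.C'.arg kE'₄ aE' = .const k' := (E₄.arg_eq_const_iff kE'₄ aE' k').mpr (Or.inl (by rw [hkE'₄]; exact hE'₃c))
  have hB₄c : E₄.C'.arg kB₄ aB = .const (case5b hcfg) :=
    (E₄.arg_eq_const_iff kB₄ aB _).mpr (Or.inl (by rw [hkB₄]; exact hB₃c))
  have hkE'B₄ : kE'₄ ≠ kB₄ := fun h => hkE'B (by rw [← hkE'₄, ← hkB₄, h])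
  have hE'₄d : kE'₄ ∈ E₄.C'.doomed := E₄.C'.mem_doomed_of_const hE'₄c
  have hB₄d : kB₄ ∈ E₄.C'.doomed := E₄.C'.mem_doomed_of_const hB₄c
  -- the output along the chain: none of the eliminated gates, so it is the image of `C.out`
  obtain ⟨ko, hko⟩ := exists_out_eq_gate' hf hF hC (by omega)
  have hC₁out : (case5C₁ hcfg).out = .gate ko := by show (C.out).substConst x (finTwoEquiv (case5c hcfg)) = _; rw [hko]; rfl
  have hout_img : ∀ (Q : Fin C.m) (k₁ : Fin (case5E₁ hf hd hF hC hS hcfg hφ' hI' αQ).C'.m) (k₂ : Fin E₂.C'.m) (k₄ : Fin E₄.C'.m),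
      (case5E₁ hf hd hF hC hS hcfg hφ' hI' αQ).ι k₁ = Q → E₂.ι k₂ = k₁ → E₄.ι k₄ = k₂ → E₄.C'.out = .gate k₄ → C.out = .gate Q := by
    intro Q k₁ k₂ k₄ h1 h2 h4 hout
    have e4 := E₄.out_eq; rw [hout, if_neg hout₃] at e4
    change Node.gate (E₄.ι k₄) = C₃.out at e4
    rw [h4] at e4
    have e3 : C₃.out = (E₂.C'.out).substConst u (finTwoEquiv c') := rfl
    rw [e3] at e4
    have e2 := E₂.out_eq; rw [if_neg houtD₁] at e2
    have e1 := (case5E₁ hf hd hF hC hS hcfg hφ' hI' αQ).out_eq; rw [if_neg (case5C₁_out_ne hf hd hF hC hS hcfg), hC₁out] at e1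
    -- `E₂.out` is a gate (the image of `ko`), so `substConst` does not change it
    cases h2o : E₂.C'.out with
    | const cc =>
      rw [h2o] at e2; change Node.const cc = (case5E₁ hf hd hF hC hS hcfg hφ' hI' αQ).C'.out at e2
      rw [← e2] at e1; cases e1
    | var i =>
      rw [h2o] at e2; change Node.var i = (case5E₁ hf hd hF hC hS hcfg hφ' hI' αQ).C'.out at e2
      rw [← e2] at e1; cases e1
    | gate g₂ =>
      rw [h2o] at e4 e2
      change Node.gate k₂ = Node.gate g₂ at e4
      cases e4
      change Node.gate (E₂.ι k₂) = (case5E₁ hf hd hF hC hS hcfg hφ' hI' αQ).C'.out at e2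
      rw [h2] at e2; rw [← e2] at e1
      change Node.gate ((case5E₁ hf hd hF hC hS hcfg hφ' hI' αQ).ι k₁) = Node.gate ko at e1
      rw [h1] at e1; cases e1; exact hko
  -- the reader `H` of `E`, and a third doomed gate
  obtain ⟨H, aH, hHE⟩ := exists_reader_of_fanout_pos (D := C) (by omega : 0 < C.fanout (.gate E))
  have hHE' : H ≠ E := fun h => by rw [h] at hHE; exact C.arg_ne_self_of_not_mem hEK _ hHE
  have hHG : H ≠ G := by
    intro h; rw [h] at hHE
    rcases fin2_eq_or_eq_rev aX aH with e' | e'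
    · rw [e', hcfg.arg_G_x] at hHE; cases hHE
    · rw [e', hcfg.arg_G_y] at hHE; cases hHE
  have hHD : H ≠ D := by
    intro h; rw [h] at hHE
    rcases fin2_eq_or_eq_rev aD aH with e' | e'
    · rw [e', hcfg.arg_D] at hHE; cases hHE; exact hEG rfl
    · rw [e', hIu] at hHE; cases hHE
  have hHE'' : H ≠ E' := by
    -- else `E` is useless: its reader `E'` reads `D`, an input of `E`
    intro h; rw [h] at hHE
    refine hS.normalized.2 E ⟨hE1, E', aH, aE, hE'E.symm, hHE, ?_⟩
    rcases fin2_eq_or_eq_rev aH aE' with e' | e'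
    · rw [e'] at hE'D; rw [hE'D] at hHE; cases hHE; exact absurd rfl hED'
    · rw [← e', hE'D, hED]
  -- images of a gate other than `G`, `D`, `E`
  have himg : ∀ (Q : Fin C.m), Q ≠ G → Q ≠ D → Q ≠ E → ∃ (k₁ : Fin (case5E₁ hf hd hF hC hS hcfg hφ' hI' αQ).C'.m) (k₂ : Fin E₂.C'.m) (k₄ : Fin E₄.C'.m),
      (case5E₁ hf hd hF hC hS hcfg hφ' hI' αQ).ι k₁ = Q ∧ E₂.ι k₂ = k₁ ∧ E₄.ι k₄ = k₂ := by
    intro Q hQG hQD hQE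
    obtain ⟨k₁, hk₁⟩ := (case5E₁ hf hd hF hC hS hcfg hφ' hI' αQ).ι_surj Q hQG
    have hk₁D : k₁ ≠ (case5kD hf hd hF hC hS hcfg hφ' hI' αQ) := by
      intro h; apply hQD; have := congrArg (case5E₁ hf hd hF hC hS hcfg hφ' hI' αQ).ι h; rw [hk₁, hkD] at this; exact this
    obtain ⟨k₂, hk₂⟩ := E₂.ι_surj k₁ hk₁D
    have hk₂E : k₂ ≠ kE₂ := fun h => hQE (by rw [← hk₁, ← hk₂, h, hkE₂, hkE₁])
    obtain ⟨k₄, hk₄⟩ := E₄.ι_surj k₂ hk₂E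
    exact ⟨k₁, k₂, k₄, hk₁, hk₂, hk₄⟩
  -- wires of such images: reading `Q'` in `C` (a gate other than `G`, `D`, `E`) means reading its image
  have hwire : ∀ (Q Q' : Fin C.m) (a : Fin 2) (k₁ : Fin (case5E₁ hf hd hF hC hS hcfg hφ' hI' αQ).C'.m) (k₂ : Fin E₂.C'.m) (k₄ : Fin E₄.C'.m)
      (k₁' : Fin (case5E₁ hf hd hF hC hS hcfg hφ' hI' αQ).C'.m) (k₂' : Fin E₂.C'.m) (k₄' : Fin E₄.C'.m),
      (case5E₁ hf hd hF hC hS hcfg hφ' hI' αQ).ι k₁ = Q → E₂.ι k₂ = k₁ → E₄.ι k₄ = k₂ → (case5E₁ hf hd hF hC hS hcfg hφ' hI' αQ).ι k₁' = Q' → E₂.ι k₂' = k₁' → E₄.ι k₄' = k₂' →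
      C.arg Q a = .gate Q' → E₄.C'.arg k₄ a = .gate k₄' := by
    intro Q Q' a k₁ k₂ k₄ k₁' k₂' k₄' h1 h2 h4 h1' h2' h4' hQ
    rw [E₄.arg_eq_gate_iff, h4, h4']; left
    show (E₂.C'.arg k₂ a).substConst u (finTwoEquiv c') = .gate k₂'
    have : E₂.C'.arg k₂ a = .gate k₂' := by
      rw [E₂.arg_eq_gate_iff, h2, h2']; left
      rw [(case5E₁ hf hd hF hC hS hcfg hφ' hI' αQ).arg_eq_gate_iff, h1, h1']; left
      exact hC₁gate.mpr hQ
    rw [this]; rfl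
  -- reading `E` in `C` means reading the constant `repl₄`
  have hwireE : ∀ (Q : Fin C.m) (a : Fin 2) (k₁ : Fin (case5E₁ hf hd hF hC hS hcfg hφ' hI' αQ).C'.m) (k₂ : Fin E₂.C'.m) (k₄ : Fin E₄.C'.m),
      (case5E₁ hf hd hF hC hS hcfg hφ' hI' αQ).ι k₁ = Q → E₂.ι k₂ = k₁ → E₄.ι k₄ = k₂ → C.arg Q a = .gate E → E₄.C'.arg k₄ a = .const (C₃.liveFn kE₂ aE k' false) := by
    intro Q a k₁ k₂ k₄ h1 h2 h4 hQ
    rw [E₄.arg_eq_const_iff, h4]; right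
    refine ⟨?_, hr₄⟩
    show (E₂.C'.arg k₂ a).substConst u (finTwoEquiv c') = .gate kE₂
    have : E₂.C'.arg k₂ a = .gate kE₂ := by
      rw [E₂.arg_eq_gate_iff, h2, hkE₂]; left
      rw [(case5E₁ hf hd hF hC hS hcfg hφ' hI' αQ).arg_eq_gate_iff, h1, hkE₁]; left
      exact hC₁gate.mpr hQ
    rw [this]; rfl
  have hthree : 3 ≤ E₄.C'.doomed.card := by
    -- a third doomed gate `k₃ ∉ {kE'₄, kB₄}`
    suffices ∃ k₃, k₃ ∈ E₄.C'.doomed ∧ k₃ ≠ kE'₄ ∧ k₃ ≠ kB₄ by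
      obtain ⟨k₃, hk₃, h1, h2⟩ := this
      have hsub : ({k₃, kE'₄, kB₄} : Finset _) ⊆ E₄.C'.doomed := by
        intro k hk
        rw [mem_insert, mem_insert, mem_singleton] at hk
        rcases hk with rfl | rfl | rfl
        · exact hk₃
        · exact hE'₄d
        · exact hB₄d
      have hcard : ({k₃, kE'₄, kB₄} : Finset _).card = 3 := by
        rw [card_insert_of_notMem (by rw [mem_insert, mem_singleton, not_or]; exact ⟨h1, h2⟩), card_pair hkE'B₄]
      have := card_le_card hsub
      omega
    by_cases hHB : H = B
    · -- `B` reads `E` and `x`: it becomes syntactically constant; a reader of it is doomed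
      have haH : aH = aB.rev := by
        rcases fin2_eq_or_eq_rev aB aH with e' | e'
        · rw [e', hHB, hcfg.arg_B] at hHE; cases hHE
        · exact e'
      have hBE₄ : E₄.C'.arg kB₄ aB.rev = .const (C₃.liveFn kE₂ aE k' false) :=
        hwireE B aB.rev _ _ _ hkB₁ hkB₂ hkB₄ (by rw [← haH, ← hHB]; exact hHE)
      have hsynB : ∃ bb, E₄.C'.SynVal (.gate kB₄) bb := by
        rcases fin2_eq_or_eq_rev 0 aB with e0 | e0
        · have h0 : E₄.C'.arg kB₄ 0 = .const (case5b hcfg) := by rw [show (0 : Fin 2) = aB from e0.symm]; exact hB₄c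
          have h1 : E₄.C'.arg kB₄ 1 = .const (C₃.liveFn kE₂ aE k' false) := by
            rw [show (1 : Fin 2) = aB.rev by rw [e0]; rfl]; exact hBE₄
          exact ⟨_, SynVal.both (by rw [h0]; exact SynVal.const _) (by rw [h1]; exact SynVal.const _) rfl⟩
        · have e1 : aB = 1 := by rw [e0]; rfl
          have h1 : E₄.C'.arg kB₄ 1 = .const (case5b hcfg) := by rw [show (1 : Fin 2) = aB from e1.symm]; exact hB₄c
          have h0 : E₄.C'.arg kB₄ 0 = .const (C₃.liveFn kE₂ aE k' false) := by
            rw [show (0 : Fin 2) = aB.rev by rw [e1]; rfl]; exact hBE₄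
          exact ⟨_, SynVal.both (by rw [h0]; exact SynVal.const _) (by rw [h1]; exact SynVal.const _) rfl⟩
      obtain ⟨bb, hbb⟩ := hsynB
      have hBout : C.out ≠ .gate B := fun hh =>
        out_ne_of_synVal hf (by omega) E₄.fair E₄.computes hbb (by
          -- `C.out = gate B` forces `E₄.out = gate kB₄`
          by_contra hne
          exact absurd hh (fun hh' => hne (by
            -- compute forward
            have e1 := (case5E₁ hf hd hF hC hS hcfg hφ' hI' αQ).out_eq; rw [if_neg (case5C₁_out_ne hf hd hF hC hS hcfg)] at e1
            have hC₁B : (case5C₁ hcfg).out = .gate B := by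
              show (C.out).substConst x (finTwoEquiv (case5c hcfg)) = _; rw [hh']; rfl
            rw [hC₁B] at e1
            have ho₁ : (case5E₁ hf hd hF hC hS hcfg hφ' hI' αQ).C'.out = .gate (case5kB₁ hf hd hF hC hS hcfg hφ' hI' αQ) := by
              apply (case5E₁ hf hd hF hC hS hcfg hφ' hI' αQ).embed_injective
              show (case5E₁ hf hd hF hC hS hcfg hφ' hI' αQ).C'.out.embed (case5E₁ hf hd hF hC hS hcfg hφ' hI' αQ).ι = (Node.gate (case5kB₁ hf hd hF hC hS hcfg hφ' hI' αQ) : Node n _).embed (case5E₁ hf hd hF hC hS hcfg hφ' hI' αQ).ι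
              rw [e1]; show Node.gate B = Node.gate ((case5E₁ hf hd hF hC hS hcfg hφ' hI' αQ).ι (case5kB₁ hf hd hF hC hS hcfg hφ' hI' αQ)); rw [hkB₁]
            have e2 := E₂.out_eq; rw [if_neg houtD₁, ho₁] at e2
            have ho₂ : E₂.C'.out = .gate kB₂ := by
              apply E₂.embed_injective
              show E₂.C'.out.embed E₂.ι = (Node.gate kB₂ : Node n _).embed E₂.ι
              rw [e2]; show Node.gate (case5kB₁ hf hd hF hC hS hcfg hφ' hI' αQ) = Node.gate (E₂.ι kB₂); rw [hkB₂]
            have ho₃ : C₃.out = .gate kB₂ := by show (E₂.C'.out).substConst u (finTwoEquiv c') = _; rw [ho₂]; rfl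
            have e4 := E₄.out_eq; rw [if_neg hout₃, ho₃] at e4
            apply E₄.embed_injective
            show E₄.C'.out.embed E₄.ι = (Node.gate kB₄ : Node n _).embed E₄.ι
            rw [e4]; show Node.gate kB₂ = Node.gate (E₄.ι kB₄); rw [hkB₄])))
      have hBpos : 0 < C.fanout (.gate B) := by
        by_contra hh; push Not at hh
        exact hBout (hN.out_of_fanout_eq_zero B (by omega))
      obtain ⟨K, aK, hKB⟩ := exists_reader_of_fanout_pos (D := C) hBpos
      have hBE : C.arg B aH = .gate E := by rw [← hHB]; exact hHE
      have hBK' : B ∉ C.xorPart := fun hBK => hEK (C.mem_of_arg_eq B hBK aH E hBE)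
      have hKG : K ≠ G := by
        intro h; rw [h] at hKB
        rcases fin2_eq_or_eq_rev aX aK with e' | e'
        · rw [e', hcfg.arg_G_x] at hKB; cases hKB
        · rw [e', hcfg.arg_G_y] at hKB; cases hKB
      have hKD : K ≠ D := by
        intro h; rw [h] at hKB
        rcases fin2_eq_or_eq_rev aD aK with e' | e'
        · rw [e', hcfg.arg_D] at hKB; cases hKB; exact hcfg.B_ne_G rfl
        · rw [e', hIu] at hKB; cases hKB
      have hKE : K ≠ E := by
        intro h; rw [h] at hKB
        exact not_reads_of_reads hBK' ⟨aK, hKB⟩ ⟨aH, hBE⟩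
      have hKB' : K ≠ B := fun h => by rw [h] at hKB; exact not_reads_self_of_standing hF hN hS.nonDegenerate B aK hKB
      obtain ⟨kK₁, kK₂, kK₄, hkK₁, hkK₂, hkK₄⟩ := himg K hKG hKD hKE
      have hK₄B : E₄.C'.arg kK₄ aK = .gate kB₄ := hwire K B aK _ _ _ _ _ _ hkK₁ hkK₂ hkK₄ hkB₁ hkB₂ hkB₄ hKB
      have hK₄d : kK₄ ∈ E₄.C'.doomed := E₄.C'.mem_doomed_of_reads hK₄B hbb
      have hkKB : kK₄ ≠ kB₄ := fun h => hKB' (by rw [← hkB₁, ← hkK₁, ← hkK₂, ← hkB₂, ← hkK₄, ← hkB₄, h])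
      by_cases hKE' : K = E'
      · -- `E' = K` reads `D` (now the constant `k'`) and `B` (syntactically constant): it is syntactically constant too
        have hkKE' : kK₄ = kE'₄ := E₄.ι_injective (by
          rw [hkK₄, hkE'₄]; exact E₂.ι_injective (by rw [hkK₂, hkE'₂]; exact (case5E₁ hf hd hF hC hS hcfg hφ' hI' αQ).ι_injective (by rw [hkK₁, hkE'₁, hKE'])))
        have haK : aK = aE'.rev := by
          rcases fin2_eq_or_eq_rev aE' aK with e' | e'
          · rw [e', hKE', hE'D] at hKB; cases hKB; exact absurd rfl (case5_B_ne_D hS hcfg).symm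
          · exact e'
        rw [hkKE', haK] at hK₄B
        have hsynE' : ∃ bb', E₄.C'.SynVal (.gate kE'₄) bb' := by
          rcases fin2_eq_or_eq_rev 0 aE' with e0 | e0
          · rw [e0] at hE'₄c hK₄B
            exact ⟨_, SynVal.both (by rw [hE'₄c]; exact SynVal.const _) (by rw [show (0 : Fin 2).rev = 1 from rfl] at hK₄B; rw [hK₄B]; exact hbb) rfl⟩
          · have e1 : aE' = 1 := by rw [e0]; rfl
            rw [e1] at hE'₄c hK₄B
            exact ⟨_, SynVal.both (by rw [show (1 : Fin 2).rev = 0 from rfl] at hK₄B; rw [hK₄B]; exact hbb) (by rw [hE'₄c]; exact SynVal.const _) rfl⟩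
        obtain ⟨bb', hbb'⟩ := hsynE'
        have hE'out : C.out ≠ .gate E' := fun hh =>
          out_ne_of_synVal hf (by omega) E₄.fair E₄.computes hbb' (by
            by_contra hne; exact hne.elim (by
              have := hout_img E' kE'₁ kE'₂ kE'₄ hkE'₁ hkE'₂ hkE'₄
              -- we need the forward direction; redo as for `B`
              have e1 := (case5E₁ hf hd hF hC hS hcfg hφ' hI' αQ).out_eq; rw [if_neg (case5C₁_out_ne hf hd hF hC hS hcfg)] at e1
              have hC₁E' : (case5C₁ hcfg).out = .gate E' := by
                show (C.out).substConst x (finTwoEquiv (case5c hcfg)) = _; rw [hh]; rfl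
              rw [hC₁E'] at e1
              have ho₁ : (case5E₁ hf hd hF hC hS hcfg hφ' hI' αQ).C'.out = .gate kE'₁ := by
                apply (case5E₁ hf hd hF hC hS hcfg hφ' hI' αQ).embed_injective
                show (case5E₁ hf hd hF hC hS hcfg hφ' hI' αQ).C'.out.embed (case5E₁ hf hd hF hC hS hcfg hφ' hI' αQ).ι = (Node.gate kE'₁ : Node n _).embed (case5E₁ hf hd hF hC hS hcfg hφ' hI' αQ).ι
                rw [e1]; show Node.gate E' = Node.gate ((case5E₁ hf hd hF hC hS hcfg hφ' hI' αQ).ι kE'₁); rw [hkE'₁]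
              have e2 := E₂.out_eq; rw [if_neg houtD₁, ho₁] at e2
              have ho₂ : E₂.C'.out = .gate kE'₂ := by
                apply E₂.embed_injective
                show E₂.C'.out.embed E₂.ι = (Node.gate kE'₂ : Node n _).embed E₂.ι
                rw [e2]; show Node.gate kE'₁ = Node.gate (E₂.ι kE'₂); rw [hkE'₂]
              have ho₃ : C₃.out = .gate kE'₂ := by show (E₂.C'.out).substConst u (finTwoEquiv c') = _; rw [ho₂]; rfl
              have e4 := E₄.out_eq; rw [if_neg hout₃, ho₃] at e4
              apply E₄.embed_injective
              show E₄.C'.out.embed E₄.ι = (Node.gate kE'₄ : Node n _).embed E₄.ι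
              rw [e4]; show Node.gate kE'₂ = Node.gate (E₄.ι kE'₄); rw [hkE'₄]))
        have hE'pos : 0 < C.fanout (.gate E') := by
          by_contra hh; push Not at hh
          exact hE'out (hN.out_of_fanout_eq_zero E' (by omega))
        obtain ⟨K', aK', hK'E'⟩ := exists_reader_of_fanout_pos (D := C) hE'pos
        have hE'K : E' ∉ C.xorPart := fun hE'K => hDK (C.mem_of_arg_eq E' hE'K aE' D hE'D)
        have hK'G : K' ≠ G := by
          intro h; rw [h] at hK'E'
          rcases fin2_eq_or_eq_rev aX aK' with e' | e'
          · rw [e', hcfg.arg_G_x] at hK'E'; cases hK'E'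
          · rw [e', hcfg.arg_G_y] at hK'E'; cases hK'E'
        have hK'D : K' ≠ D := by
          intro h; rw [h] at hK'E'
          rcases fin2_eq_or_eq_rev aD aK' with e' | e'
          · rw [e', hcfg.arg_D] at hK'E'; cases hK'E'; exact hE'G rfl
          · rw [e', hIu] at hK'E'; cases hK'E'
        have hK'E : K' ≠ E := by
          intro h; rw [h] at hK'E'
          rcases fin2_eq_or_eq_rev aE aK' with e' | e'
          · rw [e', hED] at hK'E'; cases hK'E'; exact hE'D' rfl
          · rw [e'] at hK'E'
            rcases hEo with ⟨t, ht, -⟩ | hB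
            · rw [ht] at hK'E'; cases hK'E'
            · rw [hB] at hK'E'; cases hK'E'; exact hE'B rfl
        have hK'E'' : K' ≠ E' := fun h => by rw [h] at hK'E'; exact C.arg_ne_self_of_not_mem hE'K _ hK'E'
        have hK'B : K' ≠ B := by
          intro h; rw [h] at hK'E'
          rcases fin2_eq_or_eq_rev aB aK' with e' | e'
          · rw [e', hcfg.arg_B] at hK'E'; cases hK'E'
          · rw [e', ← haH, hBE] at hK'E'; cases hK'E'; exact hE'E rfl
        obtain ⟨kK'₁, kK'₂, kK'₄, hkK'₁, hkK'₂, hkK'₄⟩ := himg K' hK'G hK'D hK'E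
        have hK'₄ : E₄.C'.arg kK'₄ aK' = .gate kE'₄ := hwire K' E' aK' _ _ _ _ _ _ hkK'₁ hkK'₂ hkK'₄ hkE'₁ hkE'₂ hkE'₄ hK'E'
        refine ⟨kK'₄, E₄.C'.mem_doomed_of_reads hK'₄ hbb', fun h => hK'E'' ?_, fun h => hK'B ?_⟩
        · rw [← hkE'₁, ← hkK'₁, ← hkK'₂, ← hkE'₂, ← hkK'₄, ← hkE'₄, h]
        · rw [← hkB₁, ← hkK'₁, ← hkK'₂, ← hkB₂, ← hkK'₄, ← hkB₄, h]
      · exact ⟨kK₄, hK₄d, fun h => hKE' (by rw [← hkE'₁, ← hkK₁, ← hkK₂, ← hkE'₂, ← hkK₄, ← hkE'₄, h]), hkKB⟩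
    · obtain ⟨kH₁, kH₂, kH₄, hkH₁, hkH₂, hkH₄⟩ := himg H hHG hHD hHE'
      have hH₄c := hwireE H aH _ _ _ hkH₁ hkH₂ hkH₄ hHE
      refine ⟨kH₄, E₄.C'.mem_doomed_of_const hH₄c, fun h => hHE'' ?_, fun h => hHB ?_⟩
      · rw [← hkE'₁, ← hkH₁, ← hkH₂, ← hkE'₂, ← hkH₄, ← hkE'₄, h]
      · rw [← hkB₁, ← hkH₁, ← hkH₂, ← hkB₂, ← hkH₄, ← hkB₄, h]
  obtain ⟨D', P', hF', hCD', hP', hm', hμ'⟩ := cascade_doomed' hf (by omega) hφ' hI' αQ 3 E₄.C' E₄.P' E₄.fair E₄.computes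
    E₄.packing hthree
  -- accounting
  have hxinf : x ∈ C.influential R := C.mem_influential_of_reads R hcfg.arg_G_x
  have hμ₁ := measure_substConst_le hφ' αI αQ C.isPacking_empty R (case5R₁ hC hS hcfg) x (finTwoEquiv (case5c hcfg))
  have hinf₁ : (1 : ℝ) ≤ ((C.influential R).card : ℝ) - ((case5C₁ hcfg).influential (case5R₁ hC hS hcfg)).card := by
    have h1 : ((case5C₁ hcfg).influential (case5R₁ hC hS hcfg)).card ≤ ((C.influential R).erase x).card :=
      card_le_card (C.influential_substConst_assignFree_subset hx hxp (case5c hcfg) (finTwoEquiv (case5c hcfg)))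
    have h3 := card_erase_add_one hxinf
    have : ((case5C₁ hcfg).influential (case5R₁ hC hS hcfg)).card + 1 ≤ (C.influential R).card := by omega
    have : (((case5C₁ hcfg).influential (case5R₁ hC hS hcfg)).card : ℝ) + 1 ≤ (C.influential R).card := by exact_mod_cast this
    linarith
  have hq₁ : ((R.quadCount : ℝ) - ((case5R₁ hC hS hcfg).quadCount : ℝ)) = 0 := by
    have : (case5R₁ hC hS hcfg).quadCount = R.quadCount := RdqSource.quadCount_assignFree hx hxp
    rw [this]; ring
  have hμE₁ := (case5E₁ hf hd hF hC hS hcfg hφ' hI' αQ).measure_le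
  have hμE₂ := E₂.measure_le
  have hμ₃ := measure_substConst_le hφ' αI αQ E₂.packing (case5R₁ hC hS hcfg) R₃ u (finTwoEquiv c')
  have huinf : u ∈ E₂.C'.influential (case5R₁ hC hS hcfg) := by
    unfold influential; rw [mem_filter]; exact ⟨mem_univ _, Or.inr ((RdqSource.protected_assignFree_iff hx hxp u).mpr hup)⟩
  have hinf₃ : (1 : ℝ) ≤ ((E₂.C'.influential (case5R₁ hC hS hcfg)).card : ℝ) - (C₃.influential R₃).card := by
    have h1 : (C₃.influential R₃).card ≤ ((E₂.C'.influential (case5R₁ hC hS hcfg)).erase u).card :=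
      card_le_card ((E₂.C'.influential_substConst_assignProtected_subset he hr c' (finTwoEquiv c')).trans (filter_subset _ _))
    have h3 := card_erase_add_one huinf
    have : (C₃.influential R₃).card + 1 ≤ (E₂.C'.influential (case5R₁ hC hS hcfg)).card := by omega
    have : ((C₃.influential R₃).card : ℝ) + 1 ≤ (E₂.C'.influential (case5R₁ hC hS hcfg)).card := by exact_mod_cast this
    linarith
  have hq₃ : (((case5R₁ hC hS hcfg).quadCount : ℝ) - (R₃.quadCount : ℝ)) = 1 := by
    have : R₃.quadCount + 1 = (case5R₁ hC hS hcfg).quadCount := RdqSource.quadCount_assignProtected he hr c'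
    have : ((R₃.quadCount : ℝ)) + 1 = (case5R₁ hC hS hcfg).quadCount := by exact_mod_cast this
    linarith
  have hμE₄ := E₄.measure_le
  refine Or.inr ⟨2, by norm_num, by norm_num, D', R₃, P', hF', hCD', hP', hdim₃, ?_⟩
  have hδ := two_liYangDelta_le αφ αI αQ
  push_cast at hμ' ⊢
  have hαI := mul_le_mul_of_nonneg_left hinf₁ hI'
  have hαI' := mul_le_mul_of_nonneg_left hinf₃ hI'
  rw [hq₁] at hμ₁
  rw [hq₃] at hμ₃
  nlinarith [hμ₁, hμE₁, hμE₂, hμ₃, hμE₄, hμ', hαI, hαI']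

end Semicircuit

end Literature.Computability.Complexity
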